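import Mathlib.Analysis.Distribution.SchwartzSpace.Deriv
import Mathlib.Analysis.SpecialFunctions.JapaneseBracket
import Mathlib.Analysis.Calculus.ParametricIntegral
import Mathlib.MeasureTheory.Integral.DominatedConvergence
import Mathlib.MeasureTheory.Group.Integral
import HarnessLib

/-!
# Polynomially bounded kernels against Schwartz functions

Topic `Literature/Analysis/FunctionSpaces`. Elementary facts about the pairing
`F ↦ ∫ g(x) F(x) dμ(x)` of a Schwartz function `F ∈ 𝓢(V, ℂ)` on a finite-dimensional real
normed space `V` (additive Haar measure `μ`) with a measurable kernel `g` of **polynomial growth**,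
`‖g x‖ ≤ C (1 + ‖x‖)ᴺ` — the form in which the slices `x ↦ 𝔚(x + iy)` of a holomorphic function of
tempered growth in a tube enter the theory of its distributional boundary values
(Streater–Wightman (1964), §2-3; Vladimirov (1966), §26; Hörmander, *ALPDO I*, Thm. 3.1.15):

* `integrable_one_add_norm_pow_mul_norm`, `integrable_mul_of_norm_le_pow` — `(1 + ‖x‖)ᴺ ‖F x‖`
  and `g F` are integrable;
* `exists_norm_integral_mul_le_seminorm` — **uniform temperedness**: for fixed `C, N` there are a
  finite set `s` of Schwartz seminorm indices and `C'` with `‖∫ g F‖ ≤ C' · (s.sup p)(F)` for *every*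
  measurable `g` with `‖g‖ ≤ C (1 + ‖·‖)ᴺ` (the weight `(1 + ‖x‖)^{-(dim V + 1)}` is integrable,
  `integrable_one_add_norm`);
* `exists_clm_integral_mul` — hence `F ↦ ∫ g F` is a tempered distribution
  (`SchwartzMap.mkCLMtoNormedSpace`);
* `hasDerivAt_integral_mul_comp_sub_smul` — **translations are differentiable under the pairing**:
  `d/du|₀ ∫ g(x) F(x − u v) dμ = −∫ g(x) (∂ᵥF)(x) dμ` (differentiation under the integral sign,
  the Schwartz decay of `DF` supplying the dominating function);
* `tendsto_integral_mul_of_dominated` — dominated convergence for families of kernels with a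
  common polynomial bound.

## References

* R. F. Streater, A. S. Wightman, *PCT, Spin and Statistics, and All That* (1964), §2-1, §2-3.
  [StreaterWightman1964]
* V. S. Vladimirov, *Methods of the Theory of Functions of Many Complex Variables* (1966), §26.
  [Vladimirov1966]

## Mathlib

`SchwartzMap.integrable_pow_mul`, `SchwartzMap.one_add_le_sup_seminorm_apply`,
`SchwartzMap.mkCLMtoNormedSpace`, `integrable_one_add_norm`,
`hasDerivAt_integral_of_dominated_loc_of_deriv_le`,
`MeasureTheory.tendsto_integral_filter_of_dominated_convergence`, the line derivative
`LineDeriv.lineDerivOp` (`∂_{v} F`) on Schwartz space.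
-/

noncomputable section

open MeasureTheory Filter Set Metric
open scoped Topology SchwartzMap LineDeriv

namespace Literature.Analysis.FunctionSpaces

variable {V : Type*} [NormedAddCommGroup V] [NormedSpace ℝ V] [FiniteDimensional ℝ V]
  [MeasurableSpace V] [BorelSpace V] {μ : Measure V} [μ.IsAddHaarMeasure]

/-! ### Integrability -/

/-- `(1 + ‖x‖)ᴺ ‖F x‖` is integrable for a Schwartz function `F` (expand the binomial and use
`SchwartzMap.integrable_pow_mul`). [folklore] -/
theorem integrable_one_add_norm_pow_mul_norm (F : 𝓢(V, ℂ)) (N : ℕ) :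
    Integrable (fun x => (1 + ‖x‖) ^ N * ‖F x‖) μ := by
  have h : ∀ x : V, (1 + ‖x‖) ^ N * ‖F x‖ =
      ∑ j ∈ Finset.range (N + 1), (N.choose j : ℝ) * (‖x‖ ^ j * ‖F x‖) := by
    intro x
    rw [add_comm, add_pow, Finset.sum_mul]
    refine Finset.sum_congr rfl fun j _ => ?_
    rw [one_pow, mul_one]
    ring
  simp_rw [h]
  exact integrable_finsetSum _ fun j _ => (F.integrable_pow_mul μ j).const_mul _

/-- A measurable kernel of polynomial growth times a Schwartz function is integrable. [folklore] -/
theorem integrable_mul_of_norm_le_pow {g : V → ℂ} (hg : AEStronglyMeasurable g μ) {C : ℝ} {N : ℕ}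
    (hle : ∀ x, ‖g x‖ ≤ C * (1 + ‖x‖) ^ N) (F : 𝓢(V, ℂ)) :
    Integrable (fun x => g x * F x) μ := by
  refine Integrable.mono' ((integrable_one_add_norm_pow_mul_norm F N).const_mul C)
    (hg.mul F.continuous.aestronglyMeasurable) (Eventually.of_forall fun x => ?_)
  rw [norm_mul]
  calc ‖g x‖ * ‖F x‖ ≤ C * (1 + ‖x‖) ^ N * ‖F x‖ :=
        mul_le_mul_of_nonneg_right (hle x) (norm_nonneg _)
    _ = C * ((1 + ‖x‖) ^ N * ‖F x‖) := by ring

omit [NormedSpace ℝ V] [FiniteDimensional ℝ V] [MeasurableSpace V] [BorelSpace V] in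
/-- The constant in a polynomial growth bound is nonnegative (evaluate at `0`). [folklore] -/
theorem nonneg_of_norm_le_pow {g : V → ℂ} {C : ℝ} {N : ℕ} (hle : ∀ x, ‖g x‖ ≤ C * (1 + ‖x‖) ^ N) :
    0 ≤ C := by
  have h := (norm_nonneg _).trans (hle 0)
  simpa using h

/-! ### Uniform temperedness of the pairing -/

/-- **Uniform temperedness.** Given `C` and `N` there are a finite set `s` of Schwartz seminorm
indices and `C' ≥ 0` such that `‖∫ g F dμ‖ ≤ C' (s.sup p)(F)` for every measurable kernel `g` with
`‖g x‖ ≤ C (1 + ‖x‖)ᴺ` and every Schwartz `F` (split `(1 + ‖x‖)ᴺ = (1 + ‖x‖)^{N+M} (1 + ‖x‖)^{-M}` with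
`M = dim V + 1`, bound the first factor against `F` by seminorms and integrate the second). This is
the temperedness of the slices of a function of polynomial growth, uniformly along the family.
[cite: StreaterWightman1964, §2-3] -/
theorem exists_norm_integral_mul_le_seminorm (μ : Measure V) [μ.IsAddHaarMeasure] (C : ℝ) (N : ℕ) :
    ∃ (s : Finset (ℕ × ℕ)) (C' : ℝ), 0 ≤ C' ∧ ∀ (g : V → ℂ), AEStronglyMeasurable g μ →
      (∀ x, ‖g x‖ ≤ C * (1 + ‖x‖) ^ N) → ∀ F : 𝓢(V, ℂ),
        ‖∫ x, g x * F x ∂μ‖ ≤ C' * (s.sup (schwartzSeminormFamily ℂ V ℂ)) F := by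
  set M : ℕ := Module.finrank ℝ V + 1 with hM
  have hMr : (Module.finrank ℝ V : ℝ) < (M : ℝ) := by rw [hM]; push_cast; linarith
  have hJ : Integrable (fun x : V => (1 + ‖x‖) ^ (-(M : ℝ))) μ := integrable_one_add_norm hMr
  set J : ℝ := ∫ x, (1 + ‖x‖) ^ (-(M : ℝ)) ∂μ with hJdef
  have hJ0 : 0 ≤ J := integral_nonneg fun x => by positivity
  set k : ℕ := N + M with hk
  refine ⟨Finset.Iic (k, 0), max C 0 * 2 ^ k * J, by positivity, fun g hg hle F => ?_⟩
  set S : ℝ := (Finset.Iic (k, 0)).sup (schwartzSeminormFamily ℂ V ℂ) F with hS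
  have hS0 : 0 ≤ S := apply_nonneg _ _
  -- pointwise bound `‖g x F x‖ ≤ max C 0 * 2^k * S * (1 + ‖x‖)^{-M}`
  have hpt : ∀ x, ‖g x * F x‖ ≤ max C 0 * 2 ^ k * S * (1 + ‖x‖) ^ (-(M : ℝ)) := by
    intro x
    have h1 : 0 < 1 + ‖x‖ := by positivity
    have hF : (1 + ‖x‖) ^ k * ‖F x‖ ≤ 2 ^ k * S := by
      have h := SchwartzMap.one_add_le_sup_seminorm_apply (𝕜 := ℂ) (m := (k, 0)) (k := k) (n := 0)
        le_rfl le_rfl F x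
      rwa [norm_iteratedFDeriv_zero] at h
    have hg' : ‖g x‖ ≤ max C 0 * (1 + ‖x‖) ^ N :=
      (hle x).trans (mul_le_mul_of_nonneg_right (le_max_left _ _) (by positivity))
    have hsplit : (1 + ‖x‖) ^ N = (1 + ‖x‖) ^ k * (1 + ‖x‖) ^ (-(M : ℝ)) := by
      rw [hk, pow_add, mul_assoc, Real.rpow_neg h1.le, ← Real.rpow_natCast _ M,
        mul_inv_cancel₀ (Real.rpow_pos_of_pos h1 _).ne', mul_one]
    rw [norm_mul]
    calc ‖g x‖ * ‖F x‖ ≤ max C 0 * (1 + ‖x‖) ^ N * ‖F x‖ :=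
          mul_le_mul_of_nonneg_right hg' (norm_nonneg _)
      _ = max C 0 * ((1 + ‖x‖) ^ k * ‖F x‖) * (1 + ‖x‖) ^ (-(M : ℝ)) := by rw [hsplit]; ring
      _ ≤ max C 0 * (2 ^ k * S) * (1 + ‖x‖) ^ (-(M : ℝ)) := by gcongr
      _ = max C 0 * 2 ^ k * S * (1 + ‖x‖) ^ (-(M : ℝ)) := by ring
  calc ‖∫ x, g x * F x ∂μ‖ ≤ ∫ x, max C 0 * 2 ^ k * S * (1 + ‖x‖) ^ (-(M : ℝ)) ∂μ :=
        norm_integral_le_of_norm_le (hJ.const_mul _) (Eventually.of_forall hpt)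
    _ = max C 0 * 2 ^ k * J * S := by rw [integral_const_mul, ← hJdef]; ring

/-- **A kernel of polynomial growth defines a tempered distribution**: `F ↦ ∫ g F dμ` is a
continuous linear functional on `𝓢(V, ℂ)`. [cite: StreaterWightman1964, §2-1] -/
theorem exists_clm_integral_mul {g : V → ℂ} (hg : AEStronglyMeasurable g μ) {C : ℝ} {N : ℕ}
    (hle : ∀ x, ‖g x‖ ≤ C * (1 + ‖x‖) ^ N) :
    ∃ L : 𝓢(V, ℂ) →L[ℂ] ℂ, ∀ F, L F = ∫ x, g x * F x ∂μ := by
  obtain ⟨s, C', hC', hbound⟩ := exists_norm_integral_mul_le_seminorm μ C N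
  refine ⟨SchwartzMap.mkCLMtoNormedSpace (𝕜 := ℂ) (𝕜' := ℂ) (σ := RingHom.id ℂ)
    (fun F => ∫ x, g x * F x ∂μ) (fun F G => ?_) (fun a F => ?_) ⟨s, C', hC', fun F => ?_⟩,
    fun F => rfl⟩
  · simp only [add_apply, mul_add]
    exact integral_add (integrable_mul_of_norm_le_pow hg hle F) (integrable_mul_of_norm_le_pow hg hle G)
  · simp only [smul_apply, smul_eq_mul, RingHom.id_apply, ← integral_const_mul]
    exact integral_congr_ae (Eventually.of_forall fun x => by ring)
  · exact hbound g hg hle F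

/-! ### Differentiating translations under the pairing -/

omit [FiniteDimensional ℝ V] [MeasurableSpace V] [BorelSpace V] in
/-- Weighted bound for the derivative of a Schwartz function at a translated point:
`(1 + ‖x‖)ᵏ ‖DF(x − w)‖ ≤ (1 + ‖w‖)ᵏ 2ᵏ (sup of seminorms of orders ≤ (k, 1))(F)`. [folklore] -/
theorem one_add_norm_pow_mul_norm_fderiv_sub_le (F : 𝓢(V, ℂ)) (k : ℕ) (x w : V) :
    (1 + ‖x‖) ^ k * ‖fderiv ℝ F (x - w)‖ ≤
      (1 + ‖w‖) ^ k * (2 ^ k * (Finset.Iic (k, 1)).sup (schwartzSeminormFamily ℂ V ℂ) F) := by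
  have h : (1 + ‖x - w‖) ^ k * ‖fderiv ℝ F (x - w)‖ ≤
      2 ^ k * (Finset.Iic (k, 1)).sup (schwartzSeminormFamily ℂ V ℂ) F := by
    have h := SchwartzMap.one_add_le_sup_seminorm_apply (𝕜 := ℂ) (m := (k, 1)) (k := k) (n := 1)
      le_rfl le_rfl F (x - w)
    rwa [norm_iteratedFDeriv_one] at h
  have hx : 1 + ‖x‖ ≤ (1 + ‖w‖) * (1 + ‖x - w‖) := by
    have : ‖x‖ ≤ ‖x - w‖ + ‖w‖ := by
      calc ‖x‖ = ‖(x - w) + w‖ := by rw [sub_add_cancel]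
        _ ≤ ‖x - w‖ + ‖w‖ := norm_add_le _ _
    nlinarith [norm_nonneg (x - w), norm_nonneg w]
  calc (1 + ‖x‖) ^ k * ‖fderiv ℝ F (x - w)‖
      ≤ ((1 + ‖w‖) * (1 + ‖x - w‖)) ^ k * ‖fderiv ℝ F (x - w)‖ := by gcongr
    _ = (1 + ‖w‖) ^ k * ((1 + ‖x - w‖) ^ k * ‖fderiv ℝ F (x - w)‖) := by rw [mul_pow]; ring
    _ ≤ (1 + ‖w‖) ^ k * (2 ^ k * (Finset.Iic (k, 1)).sup (schwartzSeminormFamily ℂ V ℂ) F) :=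
        mul_le_mul_of_nonneg_left h (by positivity)

/-- **Translations are differentiable under the pairing with a kernel of polynomial growth**:
`d/du|₀ ∫ g(x) F(x − u v) dμ(x) = −∫ g(x) (∂ᵥ F)(x) dμ(x)` (differentiation under the integral
sign; the dominating function is `(1 + ‖x‖)^{-(dim V + 1)}` times a constant, from the Schwartz
decay of `DF`). [folklore] -/
theorem hasDerivAt_integral_mul_comp_sub_smul {g : V → ℂ} (hg : AEStronglyMeasurable g μ)
    {C : ℝ} {N : ℕ} (hle : ∀ x, ‖g x‖ ≤ C * (1 + ‖x‖) ^ N) (F : 𝓢(V, ℂ)) (v : V) :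
    HasDerivAt (fun u : ℝ => ∫ x, g x * F (x - u • v) ∂μ)
      (-(∫ x, g x * (∂_{v} F) x ∂μ)) 0 := by
  have hC : 0 ≤ C := nonneg_of_norm_le_pow hle
  set M : ℕ := Module.finrank ℝ V + 1 with hM
  have hMr : (Module.finrank ℝ V : ℝ) < (M : ℝ) := by rw [hM]; push_cast; linarith
  set k : ℕ := N + M with hk
  set S : ℝ := (Finset.Iic (k, 1)).sup (schwartzSeminormFamily ℂ V ℂ) F with hS
  have hS0 : 0 ≤ S := apply_nonneg _ _
  -- the family and its derivative
  set Φ : ℝ → V → ℂ := fun u x => g x * F (x - u • v) with hΦ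
  set Φ' : ℝ → V → ℂ := fun u x => g x * -(fderiv ℝ F (x - u • v) v) with hΦ'
  have hcont : ∀ u : ℝ, Continuous fun x : V => F (x - u • v) := fun u =>
    F.continuous.comp (continuous_id.sub continuous_const)
  have hΦ_meas : ∀ᶠ u in 𝓝 (0 : ℝ), AEStronglyMeasurable (Φ u) μ :=
    Eventually.of_forall fun u => hg.mul (hcont u).aestronglyMeasurable
  have hΦ_int : Integrable (Φ 0) μ := by
    have h := integrable_mul_of_norm_le_pow hg hle F
    refine h.congr (Eventually.of_forall fun x => ?_)
    simp [hΦ]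
  have hdF : Continuous fun x : V => fderiv ℝ F x := (F.smooth 1).continuous_fderiv (by simp)
  have hΦ'_meas : AEStronglyMeasurable (Φ' 0) μ := by
    refine hg.mul (Continuous.aestronglyMeasurable ?_)
    exact ((hdF.comp (continuous_id.sub continuous_const)).clm_apply continuous_const).neg
  -- the dominating function
  set K : ℝ := C * ((1 + ‖v‖) ^ k * (2 ^ k * S)) * ‖v‖ with hK
  set bound : V → ℝ := fun x => K * (1 + ‖x‖) ^ (-(M : ℝ)) with hbound
  have hbound_int : Integrable bound μ := (integrable_one_add_norm hMr).const_mul K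
  have h_bound : ∀ᵐ x ∂μ, ∀ u ∈ ball (0 : ℝ) 1, ‖Φ' u x‖ ≤ bound x := by
    refine Eventually.of_forall fun x u hu => ?_
    have hu' : ‖u • v‖ ≤ ‖v‖ := by
      rw [norm_smul]
      have : ‖u‖ ≤ 1 := (mem_ball_zero_iff.1 hu).le
      exact mul_le_of_le_one_left (norm_nonneg _) this
    have h1 : 0 < 1 + ‖x‖ := by positivity
    have hder := one_add_norm_pow_mul_norm_fderiv_sub_le F k x (u • v)
    have hder' : (1 + ‖x‖) ^ k * ‖fderiv ℝ F (x - u • v)‖ ≤ (1 + ‖v‖) ^ k * (2 ^ k * S) :=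
      hder.trans (by gcongr)
    have hsplit : (1 + ‖x‖) ^ N = (1 + ‖x‖) ^ k * (1 + ‖x‖) ^ (-(M : ℝ)) := by
      rw [hk, pow_add, mul_assoc, Real.rpow_neg h1.le, ← Real.rpow_natCast _ M,
        mul_inv_cancel₀ (Real.rpow_pos_of_pos h1 _).ne', mul_one]
    calc ‖Φ' u x‖ = ‖g x‖ * ‖fderiv ℝ F (x - u • v) v‖ := by
          simp only [hΦ', norm_mul, norm_neg]
      _ ≤ (C * (1 + ‖x‖) ^ N) * (‖fderiv ℝ F (x - u • v)‖ * ‖v‖) := by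
          gcongr
          · exact hle x
          · exact ContinuousLinearMap.le_opNorm _ _
      _ = C * ((1 + ‖x‖) ^ k * ‖fderiv ℝ F (x - u • v)‖) * ‖v‖ * (1 + ‖x‖) ^ (-(M : ℝ)) := by
          rw [hsplit]; ring
      _ ≤ C * ((1 + ‖v‖) ^ k * (2 ^ k * S)) * ‖v‖ * (1 + ‖x‖) ^ (-(M : ℝ)) := by gcongr
      _ = bound x := by simp [hbound, hK]
  -- pointwise derivative
  have h_diff : ∀ᵐ x ∂μ, ∀ u ∈ ball (0 : ℝ) 1, HasDerivAt (Φ · x) (Φ' u x) u := by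
    refine Eventually.of_forall fun x u _ => ?_
    have hline : HasDerivAt (fun u : ℝ => x - u • v) (-v) u := by
      simpa using ((hasDerivAt_id u).smul_const v).const_sub x
    have hcomp : HasDerivAt (⇑F ∘ fun u : ℝ => x - u • v) (fderiv ℝ F (x - u • v) (-v)) u :=
      (F.hasFDerivAt (x - u • v)).comp_hasDerivAt u hline
    have hcomp' : HasDerivAt (fun u : ℝ => F (x - u • v)) (-(fderiv ℝ F (x - u • v) v)) u := by
      have h2 := hcomp
      rw [map_neg] at h2
      exact h2
    simpa [hΦ, hΦ'] using hcomp'.const_mul (g x)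
  obtain ⟨-, hderiv⟩ := hasDerivAt_integral_of_dominated_loc_of_deriv_le (ball_mem_nhds _ one_pos)
    hΦ_meas hΦ_int hΦ'_meas h_bound hbound_int h_diff
  have heq : ∫ x, Φ' 0 x ∂μ = -(∫ x, g x * (∂_{v} F) x ∂μ) := by
    rw [← integral_neg]
    refine integral_congr_ae (Eventually.of_forall fun x => ?_)
    simp [hΦ', SchwartzMap.lineDerivOp_apply_eq_fderiv]
  rw [heq] at hderiv
  exact hderiv

/-- **Translation invariance of the pairing with an invariant kernel, infinitesimal form**: if
`∫ g(x) F(x − u v) dμ` does not depend on `u` (e.g. `g` is invariant under translation by the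
multiples of `v`), then `∫ g (∂ᵥF) dμ = 0`. [folklore] -/
theorem integral_mul_lineDerivOp_eq_zero_of_forall_eq {g : V → ℂ} (hg : AEStronglyMeasurable g μ)
    {C : ℝ} {N : ℕ} (hle : ∀ x, ‖g x‖ ≤ C * (1 + ‖x‖) ^ N) (F : 𝓢(V, ℂ)) (v : V)
    (hconst : ∀ u : ℝ, ∫ x, g x * F (x - u • v) ∂μ = ∫ x, g x * F x ∂μ) :
    ∫ x, g x * (∂_{v} F) x ∂μ = 0 := by
  have h := hasDerivAt_integral_mul_comp_sub_smul hg hle F v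
  have h0 : HasDerivAt (fun u : ℝ => ∫ x, g x * F (x - u • v) ∂μ) 0 0 := by
    have : (fun u : ℝ => ∫ x, g x * F (x - u • v) ∂μ) = fun _ => ∫ x, g x * F x ∂μ := funext hconst
    rw [this]
    exact hasDerivAt_const _ _
  have := h.unique h0
  exact neg_eq_zero.1 this

/-! ### Dominated convergence for families of kernels -/

/-- **Dominated convergence for kernels with a common polynomial bound**: if `g i → g₀` pointwise
along a countably generated filter and `‖g i x‖ ≤ C (1 + ‖x‖)ᴺ` eventually, then
`∫ g i F dμ → ∫ g₀ F dμ` for every Schwartz `F`. [folklore] -/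
theorem tendsto_integral_mul_of_dominated {ι : Type*} {l : Filter ι} [l.IsCountablyGenerated]
    {g : ι → V → ℂ} {g₀ : V → ℂ} (hmeas : ∀ᶠ i in l, AEStronglyMeasurable (g i) μ) {C : ℝ} {N : ℕ}
    (hle : ∀ᶠ i in l, ∀ x, ‖g i x‖ ≤ C * (1 + ‖x‖) ^ N)
    (hlim : ∀ x, Tendsto (fun i => g i x) l (𝓝 (g₀ x))) (F : 𝓢(V, ℂ)) :
    Tendsto (fun i => ∫ x, g i x * F x ∂μ) l (𝓝 (∫ x, g₀ x * F x ∂μ)) := by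
  refine tendsto_integral_filter_of_dominated_convergence (fun x => C * (1 + ‖x‖) ^ N * ‖F x‖)
    ?_ ?_ ?_ ?_
  · filter_upwards [hmeas] with i hi using hi.mul F.continuous.aestronglyMeasurable
  · filter_upwards [hle] with i hi
    refine Eventually.of_forall fun x => ?_
    rw [norm_mul]
    exact mul_le_mul_of_nonneg_right (hi x) (norm_nonneg _)
  · have h := (integrable_one_add_norm_pow_mul_norm (μ := μ) F N).const_mul C
    refine h.congr (Eventually.of_forall fun x => ?_)
    simp only; ring
  · exact Eventually.of_forall fun x => (hlim x).mul tendsto_const_nhds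

end Literature.Analysis.FunctionSpaces

namespace Literature.Analysis.FunctionSpaces

/-! ### Pointwise majorants for translates, and the directional smearing (appended) -/

section Translates

open MeasureTheory Filter Set Metric
open scoped Topology SchwartzMap

variable {V : Type*} [NormedAddCommGroup V] [NormedSpace ℝ V]

/-- **The pointwise majorant behind `exists_norm_integral_mul_le_seminorm`**:
`(1 + ‖x‖)ᴺ ‖F x‖ ≤ 2^{N+M} S_{N+M}(F) (1 + ‖x‖)^{-M}` with `S_{N+M}` the sup of the Schwartz
seminorms of indices `≤ (N + M, 0)`. [folklore] -/
theorem one_add_norm_pow_mul_norm_le (N M : ℕ) (F : 𝓢(V, ℂ)) (x : V) :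
    (1 + ‖x‖) ^ N * ‖F x‖ ≤ 2 ^ (N + M) *
      (Finset.Iic (N + M, 0)).sup (fun m => SchwartzMap.seminorm ℂ m.1 m.2) F * (1 + ‖x‖) ^ (-(M : ℝ)) := by
  have h := SchwartzMap.one_add_le_sup_seminorm_apply (𝕜 := ℂ) (m := (N + M, 0)) (k := N + M)
    (n := 0) le_rfl le_rfl F x
  rw [norm_iteratedFDeriv_zero] at h
  have hpos : 0 < (1 + ‖x‖) ^ (M : ℝ) := by positivity
  have hsplit : (1 + ‖x‖) ^ (N + M) = (1 + ‖x‖) ^ N * (1 + ‖x‖) ^ (M : ℝ) := by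
    rw [pow_add, Real.rpow_natCast]
  rw [hsplit] at h
  rw [Real.rpow_neg (by positivity), ← div_eq_mul_inv, le_div_iff₀ hpos]
  calc (1 + ‖x‖) ^ N * ‖F x‖ * (1 + ‖x‖) ^ (M : ℝ)
      = (1 + ‖x‖) ^ N * (1 + ‖x‖) ^ (M : ℝ) * ‖F x‖ := by ring
    _ ≤ _ := h

/-- Schwartz decay: `‖F z‖ ≤ 2^M S_M(F) (1 + ‖z‖)^{-M}`. [folklore] -/
theorem norm_le_seminorm_mul_rpow_neg (M : ℕ) (F : 𝓢(V, ℂ)) (z : V) :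
    ‖F z‖ ≤ 2 ^ M * (Finset.Iic (M, 0)).sup (fun m => SchwartzMap.seminorm ℂ m.1 m.2) F *
      (1 + ‖z‖) ^ (-(M : ℝ)) := by
  simpa using one_add_norm_pow_mul_norm_le 0 M F z

omit [NormedSpace ℝ V] in
/-- `1 + ‖x‖ ≤ (1 + ‖a‖)(1 + ‖x − a‖)`. [folklore] -/
theorem one_add_norm_le_mul_one_add_norm_sub (x a : V) : 1 + ‖x‖ ≤ (1 + ‖a‖) * (1 + ‖x - a‖) := by
  have h := norm_le_insert' x a
  nlinarith [norm_nonneg a, norm_nonneg (x - a)]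

omit [NormedSpace ℝ V] in
/-- The decay weight of a translate: `(1 + ‖x − a‖)^{-M} ≤ (1 + ‖a‖)^M (1 + ‖x‖)^{-M}`. [folklore] -/
theorem rpow_neg_one_add_norm_sub_le (M : ℕ) (x a : V) :
    (1 + ‖x - a‖) ^ (-(M : ℝ)) ≤ (1 + ‖a‖) ^ M * (1 + ‖x‖) ^ (-(M : ℝ)) := by
  have h1 : 0 < 1 + ‖x‖ := by positivity
  have h2 : 0 < 1 + ‖x - a‖ := by positivity
  rw [Real.rpow_neg h1.le, Real.rpow_neg h2.le, Real.rpow_natCast, Real.rpow_natCast,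
    ← div_eq_mul_inv, le_div_iff₀ (pow_pos h1 M), inv_mul_eq_div, div_le_iff₀ (pow_pos h2 M),
    ← mul_pow]
  exact pow_le_pow_left₀ h1.le (one_add_norm_le_mul_one_add_norm_sub x a) M

variable [FiniteDimensional ℝ V] [MeasurableSpace V] [BorelSpace V] {μ : Measure V} [μ.IsAddHaarMeasure]

/-- **Uniform majorant for the translates of a Schwartz function against a kernel of polynomial
growth**: `‖g(x) F(x − a)‖ ≤ c (1 + ‖a‖)^M w(x)` with `w ≥ 0` integrable and `c, M, w` independent of
`a`. [folklore] -/
theorem exists_norm_mul_comp_sub_le {g : V → ℂ} {C : ℝ} {N : ℕ}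
    (hle : ∀ x, ‖g x‖ ≤ C * (1 + ‖x‖) ^ N) (F : 𝓢(V, ℂ)) :
    ∃ (c : ℝ) (M : ℕ) (w : V → ℝ), 0 ≤ c ∧ Integrable w μ ∧ (∀ x, 0 ≤ w x) ∧
      ∀ a x : V, ‖g x * F (x - a)‖ ≤ c * (1 + ‖a‖) ^ M * w x := by
  have hC : 0 ≤ C := nonneg_of_norm_le_pow hle
  set D : ℕ := Module.finrank ℝ V + 1 with hD
  set M : ℕ := N + D with hM
  have hDr : (Module.finrank ℝ V : ℝ) < (D : ℝ) := by rw [hD]; push_cast; linarith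
  set S : ℝ := (Finset.Iic (M, 0)).sup (fun m => SchwartzMap.seminorm ℂ m.1 m.2) F with hS
  have hS0 : 0 ≤ S := apply_nonneg _ _
  refine ⟨C * (2 ^ M * S), M, fun x => (1 + ‖x‖) ^ (-(D : ℝ)), by positivity,
    integrable_one_add_norm hDr, fun x => by positivity, fun a x => ?_⟩
  have hx1 : 0 < 1 + ‖x‖ := by positivity
  have hF : ‖F (x - a)‖ ≤ 2 ^ M * S * ((1 + ‖a‖) ^ M * (1 + ‖x‖) ^ (-(M : ℝ))) :=
    (norm_le_seminorm_mul_rpow_neg M F (x - a)).trans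
      (mul_le_mul_of_nonneg_left (rpow_neg_one_add_norm_sub_le M x a) (by positivity))
  have hpow : (1 + ‖x‖) ^ N * (1 + ‖x‖) ^ (-(M : ℝ)) = (1 + ‖x‖) ^ (-(D : ℝ)) := by
    rw [← Real.rpow_natCast, ← Real.rpow_add hx1]
    congr 1
    rw [hM]; push_cast; ring
  rw [norm_mul]
  calc ‖g x‖ * ‖F (x - a)‖
      ≤ (C * (1 + ‖x‖) ^ N) * (2 ^ M * S * ((1 + ‖a‖) ^ M * (1 + ‖x‖) ^ (-(M : ℝ)))) :=
        mul_le_mul (hle x) hF (norm_nonneg _) (by positivity)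
    _ = C * (2 ^ M * S) * (1 + ‖a‖) ^ M * ((1 + ‖x‖) ^ N * (1 + ‖x‖) ^ (-(M : ℝ))) := by ring
    _ = C * (2 ^ M * S) * (1 + ‖a‖) ^ M * (1 + ‖x‖) ^ (-(D : ℝ)) := by rw [hpow]

/-- **Fubini for the directional smearing of a Schwartz function under a kernel of polynomial
growth**: for a Schwartz `ρ` on `ℝ`,
`∫ ρ(s) (∫ g(x) F(x − s v) dμ) ds = ∫ g(x) (∫ ρ(s) F(x − s v) ds) dμ`. [folklore] -/
theorem integral_mul_integral_mul_comp_sub_smul {g : V → ℂ} (hg : AEStronglyMeasurable g μ)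
    {C : ℝ} {N : ℕ} (hle : ∀ x, ‖g x‖ ≤ C * (1 + ‖x‖) ^ N) (ρ : 𝓢(ℝ, ℂ)) (F : 𝓢(V, ℂ)) (v : V) :
    ∫ s, ρ s * (∫ x, g x * F (x - s • v) ∂μ) = ∫ x, g x * (∫ s, ρ s * F (x - s • v)) ∂μ := by
  obtain ⟨c, M, w, hc, hw, hw0, hbd⟩ := exists_norm_mul_comp_sub_le (μ := μ) hle F
  set f : ℝ → V → ℂ := fun s x => ρ s * (g x * F (x - s • v)) with hf
  -- measurability and integrability on the product
  have hmeas : AEStronglyMeasurable (Function.uncurry f) ((volume : Measure ℝ).prod μ) := by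
    have h1 : AEStronglyMeasurable (fun p : ℝ × V => ρ p.1) ((volume : Measure ℝ).prod μ) :=
      (ρ.continuous.comp continuous_fst).aestronglyMeasurable
    have h2 : AEStronglyMeasurable (fun p : ℝ × V => g p.2) ((volume : Measure ℝ).prod μ) :=
      hg.comp_snd
    have h3 : AEStronglyMeasurable (fun p : ℝ × V => F (p.2 - p.1 • v)) ((volume : Measure ℝ).prod μ) :=
      (F.continuous.comp (continuous_snd.sub (continuous_fst.smul continuous_const))).aestronglyMeasurable
    exact h1.mul (h2.mul h3)
  have hint : Integrable (Function.uncurry f) ((volume : Measure ℝ).prod μ) := by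
    have hρint : Integrable (fun s : ℝ => c * (1 + ‖v‖) ^ M * ((1 + ‖s‖) ^ M * ‖ρ s‖)) :=
      (integrable_one_add_norm_pow_mul_norm (μ := volume) ρ M).const_mul _
    refine (hρint.mul_prod hw).mono' hmeas (Eventually.of_forall fun p => ?_)
    rcases p with ⟨s, x⟩
    simp only [Function.uncurry_apply_pair, hf, norm_mul]
    have h1 := hbd (s • v) x
    rw [norm_mul] at h1
    have h2 : (1 + ‖s • v‖) ^ M ≤ (1 + ‖v‖) ^ M * (1 + ‖s‖) ^ M := by
      rw [← mul_pow, norm_smul]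
      exact pow_le_pow_left₀ (by positivity) (by nlinarith [norm_nonneg s, norm_nonneg v]) M
    calc ‖ρ s‖ * (‖g x‖ * ‖F (x - s • v)‖) ≤ ‖ρ s‖ * (c * (1 + ‖s • v‖) ^ M * w x) :=
          mul_le_mul_of_nonneg_left h1 (norm_nonneg _)
      _ ≤ ‖ρ s‖ * (c * ((1 + ‖v‖) ^ M * (1 + ‖s‖) ^ M) * w x) := by
          gcongr
          exact hw0 x
      _ = c * (1 + ‖v‖) ^ M * ((1 + ‖s‖) ^ M * ‖ρ s‖) * w x := by ring
  have hlhs : ∫ s, ρ s * (∫ x, g x * F (x - s • v) ∂μ) = ∫ s, ∫ x, f s x ∂μ := by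
    refine integral_congr_ae (Eventually.of_forall fun s => ?_)
    simp only [hf, ← integral_const_mul]
  rw [hlhs, integral_integral_swap hint]
  refine integral_congr_ae (Eventually.of_forall fun x => ?_)
  simp only [hf]
  rw [← integral_const_mul]
  refine integral_congr_ae (Eventually.of_forall fun s => ?_)
  ring

end Translates

end Literature.Analysis.FunctionSpaces
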